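import Summits.QuantumAdvantage.QuantumAdvantage.Theorems.WbwVerifiableLineNoSpeedup.Negative.PermClosure

/-!
# The adversary datum on long-cycle permutations (family, sides, relation)

Support for the crux `WhiteBoxWalk.WbwVerifiableLineNoSpeedup` (stmt-QuantumAdvantage-2239; refuter
work file `Cruxes/WbwVerifiableLineNoSpeedup/Disproof.lean` §7.1). The datum of Ambainis's weighted
relational adversary method for black-box SVL, at the level of permutations of the names: the
long-cycle family `LC m T` (`PermInstances.NoReturn T`), its sides `Xp` / `Yp` (sink `σ^T(0)` even
/ odd), the relation `Rp` of output transpositions `σ ↦ σ * swap x_k v` (`k < T`,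
`v ∉ {x_0, …, x_k}`; `Adj`), membership API, nonemptiness via the cyclic shift, the input-level
reading of the sides (promise membership, sink bit) and the card/filter commutation under the
injective encoding `permInput`. Sequels: `AdversaryLine.lean` (line formula, symmetry, total and
row counts), `AdversaryAcquire.lean` (acquire count), `AdversaryDegree.lean` (degree count),
`AdversaryBound.lean` (the lower bound `κ · min(T, √(2^m)) ≤ Q_{1/3}` for `8T ≤ 2^m`). Sorry-free.
-/

noncomputable section

set_option linter.dupNamespace false

namespace Summit.QuantumAdvantage.QuantumAdvantage.Theorems.WbwVerifiableLineNoSpeedup.Negative.Adversary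

open Finset Literature.Computability.Cryptography Literature.Computability.QuantumComplexity
  Literature.Computability.Complexity
open Summit.QuantumAdvantage.QuantumAdvantage.Theorems.WbwVerifiableLineNoSpeedup.Negative.PermInstances

variable {m T : ℕ}

/-- parity of the sink `σ^T(0)` [folklore] -/
def sinkParity (T : ℕ) (σ : Equiv.Perm (Fin (2 ^ m))) : ℕ := ((σ ^ T) (src0 m)).val % 2

open Classical in
/-- the long-cycle family [folklore] -/
def LC (m T : ℕ) : Finset (Equiv.Perm (Fin (2 ^ m))) := univ.filter fun σ => NoReturn T σ

open Classical in
/-- The left side: long-cycle permutations with EVEN sink. [folklore] -/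
def Xp (m T : ℕ) : Finset (Equiv.Perm (Fin (2 ^ m))) := (LC m T).filter fun σ => sinkParity T σ = 0

open Classical in
/-- The right side: long-cycle permutations with ODD sink. [folklore] -/
def Yp (m T : ℕ) : Finset (Equiv.Perm (Fin (2 ^ m))) := (LC m T).filter fun σ => sinkParity T σ = 1

/-- The adversary relation on permutations: `σ'` is `σ` with the outputs of `x_k` (`k < T`) and
`v ∉ {x_0, …, x_k}` swapped. [folklore] -/
def Adj (T : ℕ) (σ σ' : Equiv.Perm (Fin (2 ^ m))) : Prop :=
  ∃ k : ℕ, k < T ∧ ∃ v : Fin (2 ^ m), (∀ j ≤ k, (σ ^ j) (src0 m) ≠ v) ∧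
    σ' = transpose σ ((σ ^ k) (src0 m)) v

open Classical in
/-- The adversary relation `Rp ⊆ Xp × Yp` (pairs related by `Adj`). [folklore] -/
def Rp (m T : ℕ) : Finset (Equiv.Perm (Fin (2 ^ m)) × Equiv.Perm (Fin (2 ^ m))) :=
  (Xp m T ×ˢ Yp m T).filter fun p => Adj T p.1 p.2

/-- Membership in `LC`. [folklore] -/
theorem mem_LC_iff {σ : Equiv.Perm (Fin (2 ^ m))} : σ ∈ LC m T ↔ NoReturn T σ := by
  classical
  unfold LC; simp

/-- Members of `Xp` have no return within `T` steps. [folklore] -/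
theorem noReturn_of_mem_Xp {σ : Equiv.Perm (Fin (2 ^ m))} (h : σ ∈ Xp m T) : NoReturn T σ := by
  classical
  unfold Xp at h; rw [Finset.mem_filter] at h; exact mem_LC_iff.1 h.1

/-- Members of `Yp` have no return within `T` steps. [folklore] -/
theorem noReturn_of_mem_Yp {σ : Equiv.Perm (Fin (2 ^ m))} (h : σ ∈ Yp m T) : NoReturn T σ := by
  classical
  unfold Yp at h; rw [Finset.mem_filter] at h
  unfold LC at h; simpa using h.1

/-- For `T = 0` the relation is empty (`Adj` needs `k < T`). [folklore] -/
theorem Rp_zero (m : ℕ) : Rp m 0 = ∅ := by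
  classical
  ext p
  simp only [Finset.notMem_empty, iff_false]
  intro hp
  unfold Rp at hp
  rw [Finset.mem_filter] at hp
  obtain ⟨k, hk, -⟩ := hp.2
  omega

/-- Membership in `Rp`. [folklore] -/
theorem mem_Rp_iff {p : Equiv.Perm (Fin (2 ^ m)) × Equiv.Perm (Fin (2 ^ m))} :
    p ∈ Rp m T ↔ p.1 ∈ Xp m T ∧ p.2 ∈ Yp m T ∧ Adj T p.1 p.2 := by
  classical
  unfold Rp
  rw [Finset.mem_filter, Finset.mem_product, and_assoc]

/-- the cyclic shift `x ↦ x + 1 (mod 2^m)` [folklore] -/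
def shift (m : ℕ) : Equiv.Perm (Fin (2 ^ m)) :=
  Equiv.ofBijective (fun x : Fin (2 ^ m) => ⟨(x.val + 1) % 2 ^ m, Nat.mod_lt _ (Nat.two_pow_pos m)⟩)
    (by
      refine (Fintype.bijective_iff_injective_and_card _).2 ⟨fun x y h => ?_, rfl⟩
      have h' := Fin.mk.inj_iff.1 h
      apply Fin.ext
      have hx := x.isLt; have hy := y.isLt
      by_cases hx1 : x.val + 1 = 2 ^ m <;> by_cases hy1 : y.val + 1 = 2 ^ m
      · omega
      · rw [hx1, Nat.mod_self, Nat.mod_eq_of_lt (by omega)] at h'; omega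
      · rw [hy1, Nat.mod_self, Nat.mod_eq_of_lt (by omega)] at h'; omega
      · rw [Nat.mod_eq_of_lt (by omega), Nat.mod_eq_of_lt (by omega)] at h'; omega)

/-- `shift x = x + 1 (mod 2^m)`. [folklore] -/
theorem shift_apply_val (x : Fin (2 ^ m)) : (shift m x).val = (x.val + 1) % 2 ^ m := rfl

/-- `shift^k x = x + k (mod 2^m)`. [folklore] -/
theorem shift_pow_apply_val (k : ℕ) (x : Fin (2 ^ m)) : ((shift m ^ k) x).val = (x.val + k) % 2 ^ m := by
  induction k with
  | zero => simp [Nat.mod_eq_of_lt x.isLt]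
  | succ k ih =>
    rw [pow_succ', Equiv.Perm.mul_apply, shift_apply_val, ih, Nat.mod_add_mod, Nat.add_assoc]

/-- The cyclic shift is a single `2^m`-cycle: no return within `T < 2^m` steps. [folklore] -/
theorem noReturn_shift (hT : T < 2 ^ m) : NoReturn T (shift m) := by
  intro x k hk hkT h
  have h' := congrArg Fin.val h
  rw [shift_pow_apply_val] at h'
  have hx := x.isLt
  -- (x + k) % N = x with 1 ≤ k ≤ T < N: impossible
  have hkN : k < 2 ^ m := by omega
  rcases Nat.lt_or_ge (x.val + k) (2 ^ m) with hlt | hge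
  · rw [Nat.mod_eq_of_lt hlt] at h'; omega
  · rw [Nat.mod_eq_sub_mod hge, Nat.mod_eq_of_lt (by omega)] at h'; omega

/-- Hence the long-cycle family is nonempty for `T < 2^m`. [folklore] -/
theorem shift_mem_LC (hT : T < 2 ^ m) : shift m ∈ LC m T := by
  classical
  unfold LC
  rw [Finset.mem_filter]
  exact ⟨Finset.mem_univ _, noReturn_shift hT⟩

/-- Inputs from `Xp` have sink bit `false`. [folklore] -/
theorem svlSinkBit_of_mem_Xp {σ : Equiv.Perm (Fin (2 ^ m))} (h : σ ∈ Xp m T) :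
    svlSinkBit m T (permInput T σ) = false := by
  classical
  unfold Xp at h
  rw [Finset.mem_filter] at h
  rw [svlSinkBit_permInput (mem_LC_iff.1 h.1).atZero, decide_eq_false_iff_not]
  unfold sinkParity at h
  omega

/-- Inputs from `Yp` have sink bit `true`. [folklore] -/
theorem svlSinkBit_of_mem_Yp {σ : Equiv.Perm (Fin (2 ^ m))} (h : σ ∈ Yp m T) :
    svlSinkBit m T (permInput T σ) = true := by
  classical
  unfold Yp at h
  rw [Finset.mem_filter] at h
  rw [svlSinkBit_permInput (mem_LC_iff.1 h.1).atZero, decide_eq_true_iff]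
  exact h.2

/-- Inputs from `Xp` satisfy the promise. [folklore] -/
theorem mem_promise_of_mem_Xp {σ : Equiv.Perm (Fin (2 ^ m))} (h : σ ∈ Xp m T) :
    permInput T σ ∈ svlPromise m T := by
  classical
  unfold Xp at h; rw [Finset.mem_filter] at h
  exact permInput_mem (mem_LC_iff.1 h.1).atZero

/-- Inputs from `Yp` satisfy the promise. [folklore] -/
theorem mem_promise_of_mem_Yp {σ : Equiv.Perm (Fin (2 ^ m))} (h : σ ∈ Yp m T) :
    permInput T σ ∈ svlPromise m T := by
  classical
  unfold Yp at h; rw [Finset.mem_filter] at h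
  exact permInput_mem (mem_LC_iff.1 h.1).atZero

/-- image/filter commutation for the injective encoding [folklore] -/
theorem card_filter_image_fst (S : Finset (Equiv.Perm (Fin (2 ^ m)) × Equiv.Perm (Fin (2 ^ m))))
    (P : Equiv.Perm (Fin (2 ^ m)) × Equiv.Perm (Fin (2 ^ m)) → Prop) [DecidablePred P]
    (P' : SVLInput m T × SVLInput m T → Prop) [DecidablePred P']
    (hPP' : ∀ q, P' (Prod.map (permInput T) (permInput T) q) ↔ P q) :
    #((S.image (Prod.map (permInput T) (permInput T))).filter P') = #(S.filter P) := by
  classical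
  have hinj : Function.Injective (Prod.map (permInput (m := m) T) (permInput (m := m) T)) :=
    Function.Injective.prodMap permInput_injective permInput_injective
  rw [Finset.filter_image, Finset.card_image_of_injective _ hinj]
  congr 1
  exact Finset.filter_congr fun q _ => hPP' q


end Summit.QuantumAdvantage.QuantumAdvantage.Theorems.WbwVerifiableLineNoSpeedup.Negative.Adversary
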